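import Summits.AnomalousDissipation.AnomalousDissipation.Theorems.StirringSphereEnsembleRealizationStubAugCurrentLevelMarg
import Literature.Analysis.FluidPDE.SteadyNavierStokesProofs
import Literature.Analysis.FunctionSpaces.TorusFourierSeries

/-!
# Crux `EnsembleRealization` (stmt-AnomalousDissipation-0215) — line `augmented-lift`,
# sub-stub (M1a) `stub_augCurrentLevelPairs`, piece (L5)/Drift: base tools for the drift link

Supports stmt-AnomalousDissipation-0215 (stub `stub_augCurrentLevelPairs` of line
`augmented-lift`, piece L5 `stub_augCurrentLevelLinkTools`, DRIFT part of step (A6) of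
`augCurrent-notes.md` §3). Nothing here closes an item. Theorems only.

The DRIFT link compares the level drift `∫ ⟪a, θ Σⱼ (V z)ⱼ gⱼ⟫` with an observable `c` of the
level modes in `L¹(m_n)`. This file supplies the four ingredients that do not involve the level
package: (i) the truncated tests `P_N a` of a smooth field are admissible uniformly in `N`,
`|⟨F(u), P_N a⟩| ≤ K (1 + |u|²)` (`exists_abs_nsGeneratorPairing_fourierTruncate_le`) and
`⟨F(u), P_N a⟩ → ⟨F(u), a⟩` (`tendsto_nsGeneratorPairing_fourierTruncate`, from
`Torus.tendsto_integral_weakForm_fourierTruncate`); (ii) the Liouville equation at rest: if `μ` is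
carried by `{0}` then `⟨F(0), a⟩ = 0` (a cylindrical functional with differential `a` near the
origin), whence the a.e. convergence of the drift weights `θ_n ⟨F(u), P_{N_n} a⟩ → ⟨F(u), a⟩`
in both cases `R > 0` (`θ_n → 1`) and `R = 0` (`θ_n = 0`); (iii) a Jensen–Fubini inequality for
kernel averages `∫ |∫ ρ(z − Z u) X(u) dμ − p(z) C(z)| dz ≤ ∫ ∫ ρ(y) |X(u) − C(Z u + y)| dy dμ`
(`integral_abs_kernel_sub_le`); (iv) the pointwise limit of the mollified deviation
`∫ ρ_n(y) |X_n − c(𝓕(θ_n Σⱼ ((u, gⱼ) + yⱼ) gⱼ))| dy → |X_∞ − c(û)|` (through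
`marg_pointwise`), packaged as the last theorem `stub_augCurrentLevelDriftBaseTools`.
-/

noncomputable section

set_option linter.dupNamespace false

open MeasureTheory Set Filter Topology Function Metric UnitAddTorus
open scoped BigOperators ENNReal InnerProductSpace RealInnerProductSpace

namespace Summit.AnomalousDissipation.AnomalousDissipation.Theorems.EnsembleRealization

open Literature.Analysis.FunctionSpaces Literature.Analysis.FunctionSpaces.Torus
open Literature.Analysis.FluidPDE Literature.Analysis.FluidPDE.Torus

/-! ### Truncated test fields -/

/-- The truncations of a smooth field are bounded uniformly in the cut-off:
`‖P_N b x‖ ≤ sup ‖b‖ + Σ_k ‖b̂(k)‖`. -/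
theorem exists_norm_fourierTruncate_apply_le {b : UnitAddTorus (Fin 3) → EuclideanSpace ℝ (Fin 3)}
    (hb : IsSmooth b) : ∃ S : ℝ, 0 ≤ S ∧ ∀ (N : ℕ) (x : UnitAddTorus (Fin 3)), ‖fourierTruncate N b x‖ ≤ S := by
  obtain ⟨C, hC⟩ := isCompact_univ.exists_bound_of_continuousOn hb.continuous.continuousOn
  have hs := summable_norm_mFourierCoeff_of_isSmooth hb
  refine ⟨max C 0 + ∑' k, ‖mFourierCoeff (EuclideanSpace.complexify ∘ b) k‖,
    add_nonneg (le_max_right _ _) (tsum_nonneg fun _ => norm_nonneg _), fun N x => ?_⟩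
  refine (norm_fourierTruncate_apply_le hb N x).trans (add_le_add ((hC x (mem_univ x)).trans (le_max_left _ _)) ?_)
  exact tsum_comp_le_tsum_of_inj hs (fun _ => norm_nonneg _) Subtype.coe_injective

/-- **The truncated tests are admissible uniformly in the cut-off**: for smooth `f`, `a`,
`|⟨F(u), P_N a⟩| ≤ K (1 + |u|²)` on `H` with `K` independent of `N` (`P_N` commutes with `∂ᵢ`
and `Δ`, and the truncations of a smooth field are bounded uniformly). -/
theorem exists_abs_nsGeneratorPairing_fourierTruncate_le (ν : ℝ)
    {f a : UnitAddTorus (Fin 3) → EuclideanSpace ℝ (Fin 3)} (hf : IsSmooth f) (ha : IsSmooth a) :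
    ∃ K : ℝ, 0 ≤ K ∧ ∀ (N : ℕ) (u : Torus.energySpace (Fin 3)),
      |nsGeneratorPairing ν f u (fourierTruncate N a)| ≤ K * (1 + ‖u‖ ^ 2) := by
  obtain ⟨S₀, hS₀0, hS₀⟩ := exists_norm_fourierTruncate_apply_le ha
  obtain ⟨S₂, hS₂0, hS₂⟩ := exists_norm_fourierTruncate_apply_le ha.laplacian
  have h1 : ∀ i : Fin 3, ∃ S : ℝ, 0 ≤ S ∧ ∀ (N : ℕ) (x : UnitAddTorus (Fin 3)),
      ‖fourierTruncate N (partialDeriv i a) x‖ ≤ S := fun i =>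
    exists_norm_fourierTruncate_apply_le (ha.partialDeriv i)
  choose S₁ hS₁0 hS₁ using h1
  obtain ⟨Cf, hCf0, hCf⟩ : ∃ C : ℝ, 0 ≤ C ∧ ∀ x, ‖f x‖ ≤ C := by
    obtain ⟨C, hC⟩ := isCompact_univ.exists_bound_of_continuousOn hf.continuous.continuousOn
    exact ⟨max C 0, le_max_right _ _, fun x => (hC x (mem_univ x)).trans (le_max_left _ _)⟩
  have hS₁0' : 0 ≤ ∑ i, S₁ i := Finset.sum_nonneg fun i _ => hS₁0 i
  refine ⟨Cf * S₀ + |ν| * S₂ + ∑ i, S₁ i, by positivity, fun N u => ?_⟩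
  have hP : IsSmooth (fourierTruncate N a) := isSmooth_fourierTruncate N a
  have hu2 : MemLp (u.1 : UnitAddTorus (Fin 3) → EuclideanSpace ℝ (Fin 3)) 2 volume := Lp.memLp _
  -- the force term
  have e1 : |∫ x, ⟪f x, fourierTruncate N a x⟫_ℝ| ≤ Cf * S₀ := by
    rw [← Real.norm_eq_abs]
    have h := norm_integral_le_of_norm_le_const (μ := (volume : Measure (UnitAddTorus (Fin 3))))
      (f := fun x => ⟪f x, fourierTruncate N a x⟫_ℝ) (C := Cf * S₀) (Eventually.of_forall fun x =>
        (norm_inner_le_norm _ _).trans (mul_le_mul (hCf x) (hS₀ N x) (norm_nonneg _) hCf0))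
    rwa [probReal_univ, mul_one] at h
  -- the viscous term
  have e2 : |∫ x, ⟪(u.1 : UnitAddTorus (Fin 3) → EuclideanSpace ℝ (Fin 3)) x,
      laplacian (fourierTruncate N a) x⟫_ℝ| ≤ S₂ * (1 + ‖u‖ ^ 2) := by
    have hi : Integrable (fun x => S₂ * (1 + ‖(u.1 : UnitAddTorus (Fin 3) → EuclideanSpace ℝ (Fin 3)) x‖ ^ 2))
        volume := ((integrable_const (1 : ℝ)).add (hu2.integrable_norm_pow two_ne_zero)).const_mul S₂
    have hpt : ∀ x, ‖⟪(u.1 : UnitAddTorus (Fin 3) → EuclideanSpace ℝ (Fin 3)) x,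
        laplacian (fourierTruncate N a) x⟫_ℝ‖ ≤
        S₂ * (1 + ‖(u.1 : UnitAddTorus (Fin 3) → EuclideanSpace ℝ (Fin 3)) x‖ ^ 2) := fun x => by
      refine (norm_inner_le_norm _ _).trans ?_
      rw [laplacian_fourierTruncate ha N x]
      have h := hS₂ N x
      nlinarith [norm_nonneg ((u.1 : UnitAddTorus (Fin 3) → EuclideanSpace ℝ (Fin 3)) x),
        norm_nonneg (fourierTruncate N (laplacian a) x),
        sq_nonneg (‖(u.1 : UnitAddTorus (Fin 3) → EuclideanSpace ℝ (Fin 3)) x‖ - 1)]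
    rw [← Real.norm_eq_abs]
    refine (norm_integral_le_of_norm_le hi (Eventually.of_forall hpt)).trans_eq ?_
    rw [integral_const_mul, integral_add (integrable_const _) (hu2.integrable_norm_pow two_ne_zero),
      integral_const, probReal_univ, one_smul, integral_norm_sq_coe_eq, Submodule.coe_norm]
  -- the inertial term
  have hC : ∀ x, ∑ i, ‖partialDeriv i (fourierTruncate N a) x‖ ≤ ∑ i, S₁ i := fun x =>
    Finset.sum_le_sum fun i _ => by rw [partialDeriv_fourierTruncate ha N i x]; exact hS₁ i N x
  have e3 := (integrable_inner_fderiv_apply_coe hP hC u.1 u.1).2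
  unfold nsGeneratorPairing inertialPairing
  calc |(∫ x, ⟪f x, fourierTruncate N a x⟫_ℝ) +
          ν * (∫ x, ⟪(u.1 : UnitAddTorus (Fin 3) → EuclideanSpace ℝ (Fin 3)) x, laplacian (fourierTruncate N a) x⟫_ℝ) +
          ∫ x, ⟪fderiv (fourierTruncate N a) x ((u.1 : UnitAddTorus (Fin 3) → EuclideanSpace ℝ (Fin 3)) x),
            (u.1 : UnitAddTorus (Fin 3) → EuclideanSpace ℝ (Fin 3)) x⟫_ℝ|
      ≤ |∫ x, ⟪f x, fourierTruncate N a x⟫_ℝ| +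
          |ν * ∫ x, ⟪(u.1 : UnitAddTorus (Fin 3) → EuclideanSpace ℝ (Fin 3)) x, laplacian (fourierTruncate N a) x⟫_ℝ| +
          |∫ x, ⟪fderiv (fourierTruncate N a) x ((u.1 : UnitAddTorus (Fin 3) → EuclideanSpace ℝ (Fin 3)) x),
            (u.1 : UnitAddTorus (Fin 3) → EuclideanSpace ℝ (Fin 3)) x⟫_ℝ| := abs_add_three _ _ _
    _ ≤ Cf * S₀ + |ν| * (S₂ * (1 + ‖u‖ ^ 2)) + (∑ i, S₁ i) * (‖u‖ * ‖u‖) := by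
        rw [abs_mul]
        exact add_le_add_three e1 (mul_le_mul_of_nonneg_left e2 (abs_nonneg ν)) e3
    _ ≤ (Cf * S₀ + |ν| * S₂ + ∑ i, S₁ i) * (1 + ‖u‖ ^ 2) := by
        nlinarith [sq_nonneg ‖u‖, mul_nonneg hCf0 hS₀0, abs_nonneg ν]

/-- **Removing the truncation of the test**: `⟨F(u), P_N a⟩ → ⟨F(u), a⟩` as `N → ∞`, for every
`u ∈ H` and smooth `f`, `a` (`Torus.tendsto_integral_weakForm_fourierTruncate` in the flux form
`Torus.nsGeneratorPairing_eq_flux`). -/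
theorem tendsto_nsGeneratorPairing_fourierTruncate (ν : ℝ)
    {f a : UnitAddTorus (Fin 3) → EuclideanSpace ℝ (Fin 3)} (hf : IsSmooth f) (ha : IsSmooth a)
    (u : Torus.energySpace (Fin 3)) :
    Tendsto (fun N => nsGeneratorPairing ν f u (fourierTruncate N a)) atTop (𝓝 (nsGeneratorPairing ν f u a)) := by
  have hf2 : MemLp f 2 volume := hf.memLp 2
  have hu2 : MemLp (u.1 : UnitAddTorus (Fin 3) → EuclideanSpace ℝ (Fin 3)) 2 volume := Lp.memLp _
  rw [nsGeneratorPairing_eq_flux ν hf2 ha (U := u) EventuallyEq.rfl]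
  refine (tendsto_integral_weakForm_fourierTruncate ν hf2 hu2 ha).congr fun N => ?_
  exact (nsGeneratorPairing_eq_flux ν hf2 (isSmooth_fourierTruncate N a) (U := u) EventuallyEq.rfl).symm

/-! ### The Liouville equation at rest -/

-- adapted from Theorems/TaylorCertificatesFloorCertificateEnsembleCeilingStubLinearLiouville.lean
-- (`exists_cylindricalTest_grad_eq_of_lt`)
/-- A cylindrical functional (one coordinate `(·, w)`, profile `y ↦ y₀ χ(y)` with `χ` a smooth bump
`≡ 1` on the closed unit ball) whose differential is the given test field `w ∈ 𝒱` at every `u`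
with `|(u, w)| < 1`. -/
theorem exists_cylindricalTest_grad_eq {w : UnitAddTorus (Fin 3) → EuclideanSpace ℝ (Fin 3)}
    (hw : IsSmooth w) (hdw : IsDivFree w) (hzw : HasZeroMean w) :
    ∃ Φ : CylindricalTest (Fin 3), ∀ u : Torus.energySpace (Fin 3), |pairing u.1 w| < 1 → Φ.grad u = w := by
  let χ : ContDiffBump (0 : EuclideanSpace ℝ (Fin 1)) := ⟨1, 2, one_pos, one_lt_two⟩
  have hL_diff : ContDiff ℝ 1 (EuclideanSpace.proj (𝕜 := ℝ) (0 : Fin 1) : EuclideanSpace ℝ (Fin 1) → ℝ) :=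
    (EuclideanSpace.proj (𝕜 := ℝ) (0 : Fin 1)).contDiff
  have hχ_diff : ContDiff ℝ 1 (χ : EuclideanSpace ℝ (Fin 1) → ℝ) := χ.contDiff
  let Φ : CylindricalTest (Fin 3) :=
    { m := 1
      g := fun _ => w
      g_smooth := fun _ => hw
      g_divFree := fun _ => hdw
      g_zeroMean := fun _ => hzw
      φ := fun y => EuclideanSpace.proj (𝕜 := ℝ) (0 : Fin 1) y * χ y
      φ_contDiff := hL_diff.mul hχ_diff
      φ_compact := χ.hasCompactSupport.mul_left }
  refine ⟨Φ, fun u hu => ?_⟩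
  set y₀ : EuclideanSpace ℝ (Fin 1) := Φ.coords u with hy₀
  have hy₀c : y₀ = WithLp.toLp 2 (fun _ : Fin 1 => pairing u.1 w) := rfl
  have hball : y₀ ∈ ball (0 : EuclideanSpace ℝ (Fin 1)) χ.rIn := by
    rw [mem_ball, dist_zero_right, hy₀c, EuclideanSpace.norm_eq]
    simp only [Fin.sum_univ_one, Real.norm_eq_abs, sq_abs]
    rw [Real.sqrt_sq_eq_abs]
    exact hu
  have hχ1 : (χ : EuclideanSpace ℝ (Fin 1) → ℝ) y₀ = 1 := χ.one_of_mem_closedBall (ball_subset_closedBall hball)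
  have hχ' : _root_.fderiv ℝ (χ : EuclideanSpace ℝ (Fin 1) → ℝ) y₀ = 0 := by
    rw [(χ.eventuallyEq_one_of_mem_ball hball).fderiv_eq]
    exact fderiv_const_apply (1 : ℝ)
  have hderiv : _root_.fderiv ℝ Φ.φ (Φ.coords u) (EuclideanSpace.single (0 : Fin 1) (1 : ℝ)) = 1 := by
    rw [← hy₀]
    change _root_.fderiv ℝ (fun y => EuclideanSpace.proj (𝕜 := ℝ) (0 : Fin 1) y * χ y) y₀
      (EuclideanSpace.single (0 : Fin 1) (1 : ℝ)) = 1
    have hfun : (fun y => EuclideanSpace.proj (𝕜 := ℝ) (0 : Fin 1) y * (χ : EuclideanSpace ℝ (Fin 1) → ℝ) y) =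
        (EuclideanSpace.proj (𝕜 := ℝ) (0 : Fin 1) : EuclideanSpace ℝ (Fin 1) → ℝ) *
          (χ : EuclideanSpace ℝ (Fin 1) → ℝ) := rfl
    rw [hfun, fderiv_mul (hL_diff.differentiable one_ne_zero y₀) (hχ_diff.differentiable one_ne_zero y₀),
      hχ1, hχ', smul_zero, zero_add, one_smul, ContinuousLinearMap.fderiv]
    simp
  funext x
  change ∑ i : Fin 1, (_root_.fderiv ℝ Φ.φ (Φ.coords u) (EuclideanSpace.single i 1)) • Φ.g i x = w x
  rw [Fin.sum_univ_one, hderiv, one_smul]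

/-- **The Liouville equation at rest.** If the stationary statistical solution `μ` is carried by
`{0}` (`|u| ≤ 0` a.e.), then `⟨F(u), a⟩ = 0` for `μ`-a.e. `u` and every test field `a ∈ 𝒱`:
the cylindrical functional of `exists_cylindricalTest_grad_eq` has `Φ'(u) = a` a.e., so
`∫ ⟨F(u), a⟩ dμ = 0`, and the integrand is a.e. the constant `⟨F(0), a⟩`. -/
theorem ae_nsGeneratorPairing_eq_zero_of_norm_le_zero {ν : ℝ} {f : UnitAddTorus (Fin 3) → EuclideanSpace ℝ (Fin 3)}
    {μ : Measure (Torus.energySpace (Fin 3))} (hμ : IsStationaryStatisticalSolution ν f μ)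
    (hR : ∀ᵐ u ∂μ, ‖u‖ ≤ 0) {a : UnitAddTorus (Fin 3) → EuclideanSpace ℝ (Fin 3)} (ha : IsSmooth a)
    (hadiv : IsDivFree a) (hamean : HasZeroMean a) :
    ∀ᵐ u ∂μ, nsGeneratorPairing ν f u a = 0 := by
  haveI := hμ.prob
  obtain ⟨Φ, hΦ⟩ := exists_cylindricalTest_grad_eq ha hadiv hamean
  have h0 : ∀ᵐ u ∂μ, u = 0 := hR.mono fun u hu => norm_le_zero_iff.1 hu
  have hgrad : ∀ᵐ u ∂μ, Φ.grad u = a := h0.mono fun u hu => hΦ u (by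
    have h := abs_pairing_coe_le (ha.memLp 2) u
    rw [hu, norm_zero, zero_mul] at h
    rw [hu]
    exact h.trans_lt one_pos)
  obtain ⟨-, hzero⟩ := hμ.generator Φ
  have hae : (fun u => nsGeneratorPairing ν f u (Φ.grad u)) =ᵐ[μ] fun u => nsGeneratorPairing ν f u a :=
    hgrad.mono fun u hu => by simp only [hu]
  have hconst : (fun u => nsGeneratorPairing ν f u a) =ᵐ[μ] fun _ => nsGeneratorPairing ν f 0 a :=
    h0.mono fun u hu => by simp only [hu]
  rw [integral_congr_ae hae, integral_congr_ae hconst, integral_const, probReal_univ, one_smul] at hzero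
  exact hconst.mono fun u hu => hu.trans hzero

/-- **a.e. convergence of the drift weights** `θ_n ⟨F(u), P_{N n} a⟩ → ⟨F(u), a⟩` on a ball
`|u| ≤ R` carrying `μ`, `θ_n = R/(R + δ_n)`, `δ_n → 0`, `N n → ∞`: for `R > 0`, `θ_n → 1` and
`tendsto_nsGeneratorPairing_fourierTruncate`; for `R = 0`, `θ_n = 0`, and `⟨F(u), a⟩ = 0` a.e. by
`ae_nsGeneratorPairing_eq_zero_of_norm_le_zero`. -/
theorem ae_tendsto_theta_mul_nsGeneratorPairing {ν : ℝ} {f : UnitAddTorus (Fin 3) → EuclideanSpace ℝ (Fin 3)}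
    {μ : Measure (Torus.energySpace (Fin 3))} (hf : IsSmooth f) (hμ : IsStationaryStatisticalSolution ν f μ)
    {R : ℝ} (hR : ∀ᵐ u ∂μ, ‖u‖ ≤ R) (hR0 : 0 ≤ R) (N : ℕ → ℕ) (δ θ : ℕ → ℝ)
    (hN : Tendsto N atTop atTop) (hδ0 : Tendsto δ atTop (𝓝 0)) (hθ : ∀ n, θ n = R / (R + δ n))
    {a : UnitAddTorus (Fin 3) → EuclideanSpace ℝ (Fin 3)} (ha : IsSmooth a) (hadiv : IsDivFree a)
    (hamean : HasZeroMean a) :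
    ∀ᵐ u ∂μ, Tendsto (fun n => θ n * nsGeneratorPairing ν f u (fourierTruncate (N n) a)) atTop
      (𝓝 (nsGeneratorPairing ν f u a)) := by
  rcases hR0.lt_or_eq with hRpos | hR0'
  · have hθ1 : Tendsto θ atTop (𝓝 1) := by
      have h : Tendsto (fun n => R / (R + δ n)) atTop (𝓝 (R / (R + 0))) :=
        tendsto_const_nhds.div (tendsto_const_nhds.add hδ0) (by rw [add_zero]; exact hRpos.ne')
      rw [add_zero, div_self hRpos.ne'] at h
      exact h.congr' (Eventually.of_forall fun n => (hθ n).symm)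
    refine Eventually.of_forall fun u => ?_
    have h := hθ1.mul ((tendsto_nsGeneratorPairing_fourierTruncate ν hf ha u).comp hN)
    rw [one_mul] at h
    exact h
  · subst hR0'
    have hθ0 : ∀ n, θ n = 0 := fun n => by rw [hθ n, zero_div]
    filter_upwards [ae_nsGeneratorPairing_eq_zero_of_norm_le_zero hμ hR ha hadiv hamean] with u hu
    simp_rw [hθ0, zero_mul, hu]
    exact tendsto_const_nhds

/-! ### A Jensen–Fubini inequality for kernel averages -/

/-- **Jensen–Fubini inequality for a mollified weighted law.** For a probability measure `μ`, a
measurable coordinate map `Z`, a continuous bounded integrable kernel `ρ ≥ 0`, a weight `X` with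
`|X| ≤ M` a.e. and a continuous observable `C` with `|C| ≤ B`: the mollified deviation
`u ↦ ∫ ρ(y) |X(u) − C(Z u + y)| dy` is integrable and a.e. bounded by `(M + B) ∫ ρ`, the weighted
law `z ↦ ∫ ρ(z − Z u) X(u) dμ − (∫ ρ(z − Z u) dμ) C(z)` is integrable,
`∫ |∫ ρ(z − Z u) X(u) dμ − (∫ ρ(z − Z u) dμ) C(z)| dz ≤ ∫ (∫ ρ(y) |X(u) − C(Z u + y)| dy) dμ`
(Jensen in `u`, Fubini, translation `z = Z u + y`), and `|∫ ρ(z − Z u) X(u) dμ| ≤ M ∫ ρ(z − Z u) dμ`. -/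
theorem integral_abs_kernel_sub_le {Ω : Type*} [MeasurableSpace Ω] (μ : Measure Ω) [IsProbabilityMeasure μ]
    {E : Type*} [NormedAddCommGroup E] [NormedSpace ℝ E] [FiniteDimensional ℝ E]
    [MeasurableSpace E] [BorelSpace E] (vol : Measure E) [SFinite vol] [vol.IsAddRightInvariant]
    {Z : Ω → E} (hZ : Measurable Z) {ρ : E → ℝ} (hρ : Continuous ρ) (hρ0 : ∀ y, 0 ≤ ρ y) {Kρ : ℝ}
    (hρK : ∀ y, ρ y ≤ Kρ) (hρi : Integrable ρ vol)
    {X : Ω → ℝ} (hXm : AEStronglyMeasurable X μ) {M : ℝ} (hXM : ∀ᵐ u ∂μ, |X u| ≤ M)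
    {C : E → ℝ} (hC : Continuous C) {B : ℝ} (hB : ∀ z, |C z| ≤ B) :
    Integrable (fun u => ∫ y, ρ y * |X u - C (Z u + y)| ∂vol) μ ∧
    (∀ᵐ u ∂μ, |∫ y, ρ y * |X u - C (Z u + y)| ∂vol| ≤ (M + B) * ∫ y, ρ y ∂vol) ∧
    Integrable (fun z => (∫ u, ρ (z - Z u) * X u ∂μ) - (∫ u, ρ (z - Z u) ∂μ) * C z) vol ∧
    ∫ z, |(∫ u, ρ (z - Z u) * X u ∂μ) - (∫ u, ρ (z - Z u) ∂μ) * C z| ∂vol ≤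
      ∫ u, ∫ y, ρ y * |X u - C (Z u + y)| ∂vol ∂μ ∧
    (∀ z, |∫ u, ρ (z - Z u) * X u ∂μ| ≤ M * ∫ u, ρ (z - Z u) ∂μ) := by
  -- the joint integrand `H (z, u) = ρ (z - Z u) (X u - C z)` is integrable on `vol ⊗ μ`
  have hK : Integrable (fun p : E × Ω => ρ (p.1 - Z p.2)) (vol.prod μ) := by
    have h := integrable_obs_mul_kernel_sub μ vol hZ hρ hρi continuous_const (G := fun _ => (1 : ℝ)) (B := 1)
      (fun _ => by simp)
    exact h.congr (Eventually.of_forall fun p => by simp [uncurry])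
  have hkm : Measurable fun p : E × Ω => ρ (p.1 - Z p.2) :=
    hρ.measurable.comp (measurable_fst.sub (hZ.comp measurable_snd))
  have hHm : AEStronglyMeasurable (fun p : E × Ω => ρ (p.1 - Z p.2) * (X p.2 - C p.1)) (vol.prod μ) :=
    hkm.aestronglyMeasurable.mul (hXm.comp_snd.sub (hC.measurable.comp measurable_fst).aestronglyMeasurable)
  have hXM' : ∀ᵐ p ∂(vol.prod μ), |X p.2| ≤ M := (Measure.quasiMeasurePreserving_snd (μ := vol) (ν := μ)).ae hXM
  have hH : Integrable (fun p : E × Ω => ρ (p.1 - Z p.2) * (X p.2 - C p.1)) (vol.prod μ) := by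
    refine (hK.const_mul (M + B)).mono' hHm (hXM'.mono fun p hp => ?_)
    rw [Real.norm_eq_abs, abs_mul, abs_of_nonneg (hρ0 _), mul_comm]
    exact mul_le_mul_of_nonneg_right ((abs_sub _ _).trans (add_le_add hp (hB _))) (hρ0 _)
  -- slices in `u`
  have hK0 : 0 ≤ Kρ := (hρ0 0).trans (hρK 0)
  have hkzm : ∀ z, AEStronglyMeasurable (fun u => ρ (z - Z u)) μ := fun z =>
    (hρ.measurable.comp (measurable_const.sub hZ)).aestronglyMeasurable
  have hρZi : ∀ z, Integrable (fun u => ρ (z - Z u)) μ := fun z =>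
    Integrable.of_bound (hkzm z) Kρ (Eventually.of_forall fun u => by
      rw [Real.norm_eq_abs, abs_of_nonneg (hρ0 _)]; exact hρK _)
  have hρXi : ∀ z, Integrable (fun u => ρ (z - Z u) * X u) μ := fun z =>
    Integrable.of_bound ((hkzm z).mul hXm) (Kρ * M) (hXM.mono fun u hu => by
      rw [Real.norm_eq_abs, abs_mul, abs_of_nonneg (hρ0 _)]
      exact mul_le_mul (hρK _) hu (abs_nonneg _) hK0)
  have hslice : ∀ z, ∫ u, ρ (z - Z u) * (X u - C z) ∂μ =
      (∫ u, ρ (z - Z u) * X u ∂μ) - (∫ u, ρ (z - Z u) ∂μ) * C z := fun z => by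
    simp_rw [mul_sub]
    rw [integral_sub (hρXi z) ((hρZi z).mul_const _), integral_mul_const]
  -- translation `z = Z u + y`
  have htrans : ∀ u, ∫ z, ‖ρ (z - Z u) * (X u - C z)‖ ∂vol = ∫ y, ρ y * |X u - C (Z u + y)| ∂vol := fun u => by
    rw [← integral_add_right_eq_self (fun z => ‖ρ (z - Z u) * (X u - C z)‖) (Z u)]
    refine integral_congr_ae (Eventually.of_forall fun y => ?_)
    simp only
    rw [Real.norm_eq_abs, abs_mul, abs_of_nonneg (hρ0 _), add_sub_cancel_right, add_comm]
  have hI1 : Integrable (fun u => ∫ y, ρ y * |X u - C (Z u + y)| ∂vol) μ := by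
    have h := hH.norm.integral_prod_right
    exact h.congr (Eventually.of_forall htrans)
  have hI2 : ∀ᵐ u ∂μ, |∫ y, ρ y * |X u - C (Z u + y)| ∂vol| ≤ (M + B) * ∫ y, ρ y ∂vol :=
    hXM.mono fun u hu => by
      rw [← Real.norm_eq_abs, ← integral_const_mul]
      refine norm_integral_le_of_norm_le (hρi.const_mul _) (Eventually.of_forall fun y => ?_)
      rw [Real.norm_eq_abs, abs_mul, abs_of_nonneg (hρ0 y), abs_abs, mul_comm]
      exact mul_le_mul_of_nonneg_right ((abs_sub _ _).trans (add_le_add hu (hB _))) (hρ0 y)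
  have hI3 : Integrable (fun z => (∫ u, ρ (z - Z u) * X u ∂μ) - (∫ u, ρ (z - Z u) ∂μ) * C z) vol :=
    hH.integral_prod_left.congr (Eventually.of_forall hslice)
  have hI5 : ∀ z, |∫ u, ρ (z - Z u) * X u ∂μ| ≤ M * ∫ u, ρ (z - Z u) ∂μ := fun z => by
    rw [← Real.norm_eq_abs, ← integral_const_mul]
    refine norm_integral_le_of_norm_le ((hρZi z).const_mul M) (hXM.mono fun u hu => ?_)
    rw [Real.norm_eq_abs, abs_mul, abs_of_nonneg (hρ0 _), mul_comm]
    exact mul_le_mul_of_nonneg_right hu (hρ0 _)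
  refine ⟨hI1, hI2, hI3, ?_, hI5⟩
  calc ∫ z, |(∫ u, ρ (z - Z u) * X u ∂μ) - (∫ u, ρ (z - Z u) ∂μ) * C z| ∂vol
      = ∫ z, ‖∫ u, ρ (z - Z u) * (X u - C z) ∂μ‖ ∂vol :=
        integral_congr_ae (Eventually.of_forall fun z => by simp only; rw [Real.norm_eq_abs, hslice])
    _ ≤ ∫ z, ∫ u, ‖ρ (z - Z u) * (X u - C z)‖ ∂μ ∂vol :=
        integral_mono_of_nonneg (Eventually.of_forall fun _ => norm_nonneg _) hH.norm.integral_prod_left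
          (Eventually.of_forall fun z => norm_integral_le_integral_norm _)
    _ = ∫ u, ∫ z, ‖ρ (z - Z u) * (X u - C z)‖ ∂vol ∂μ := integral_integral_swap hH.norm
    _ = ∫ u, ∫ y, ρ y * |X u - C (Z u + y)| ∂vol ∂μ := integral_congr_ae (Eventually.of_forall htrans)

/-! ### Pointwise limit of the mollified deviation -/

/-- **Drift base tools for (M1a), piece (L5): pointwise convergence of the mollified drift
deviation, uniformly over the box.** For `u` in the ball, scalars `X n → Xlim`, kernels `ρ n ≥ 0`
of mass one carried by the box `‖y.1‖ < δ n`, `|y.2| < δ n`, and a bounded continuous test `c` of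
the modes: `∫ ρ_n(y) |X n − c(𝓕(θ_n Σⱼ ((u, gⱼ) + yⱼ) gⱼ))| dy → |Xlim − c(û)|` (`marg_pointwise`). -/
theorem stub_augCurrentLevelDriftBaseTools {R : ℝ} (hR0 : 0 ≤ R)
    (D : ℕ → ℕ) (g : (n : ℕ) → Fin (D n) → UnitAddTorus (Fin 3) → EuclideanSpace ℝ (Fin 3))
    (N : ℕ → ℕ) (δ θ : ℕ → ℝ)
    (hN : Tendsto N atTop atTop) (hδ : ∀ n, 0 < δ n) (hδ0 : Tendsto δ atTop (𝓝 0))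
    (hθ : ∀ n, θ n = R / (R + δ n))
    (hg : ∀ n j, IsSmooth (g n j)) (horth : ∀ n i j, ∫ x, ⟪g n i x, g n j x⟫_ℝ = if i = j then 1 else 0)
    (u : Torus.energySpace (Fin 3)) (hu : ‖u‖ ≤ R)
    (hgH : ∀ n x, ∑ j, pairing u.1 (g n j) • g n j x =
      fourierTruncate (N n) (u.1 : UnitAddTorus (Fin 3) → EuclideanSpace ℝ (Fin 3)) x)
    (ρ : (n : ℕ) → EuclideanSpace ℝ (Fin (D n)) × ℝ → ℝ) (hρ0 : ∀ n y, 0 ≤ ρ n y)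
    (hρi : ∀ n, Integrable (ρ n) ((volume : Measure (EuclideanSpace ℝ (Fin (D n)))).prod (volume : Measure ℝ)))
    (hρ1 : ∀ n, ∫ y, ρ n y ∂((volume : Measure (EuclideanSpace ℝ (Fin (D n)))).prod (volume : Measure ℝ)) = 1)
    (hρδ : ∀ n y, ρ n y ≠ 0 → ‖y.1‖ < δ n ∧ |y.2| < δ n)
    {c : ((Fin 3 → ℤ) → EuclideanSpace ℂ (Fin 3)) → ℝ} (hc : Continuous c) {B : ℝ} (hB : ∀ w, |c w| ≤ B)
    (X : ℕ → ℝ) (Xlim : ℝ) (hX : Tendsto X atTop (𝓝 Xlim)) :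
    Tendsto (fun n => ∫ y, ρ n y * |X n - c (fun k : Fin 3 → ℤ => mFourierCoeff (EuclideanSpace.complexify ∘
        fun x => θ n • ∑ j, ((WithLp.toLp 2 fun j => pairing u.1 (g n j)) + y.1) j • g n j x) k)|
        ∂((volume : Measure (EuclideanSpace ℝ (Fin (D n)))).prod (volume : Measure ℝ))) atTop
      (𝓝 |Xlim - c (fun k : Fin 3 → ℤ => mFourierCoeff (EuclideanSpace.complexify ∘
        (u.1 : UnitAddTorus (Fin 3) → EuclideanSpace ℝ (Fin 3))) k)|) := by
  -- the level modes of the shifted coordinates and the limit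
  let Ψ : (n : ℕ) → EuclideanSpace ℝ (Fin (D n)) × ℝ → ((Fin 3 → ℤ) → EuclideanSpace ℂ (Fin 3)) := fun n y k =>
    mFourierCoeff (EuclideanSpace.complexify ∘ fun x => θ n • ∑ j,
      ((WithLp.toLp 2 fun j => pairing u.1 (g n j)) + y.1) j • g n j x) k
  let x₀ : (Fin 3 → ℤ) → EuclideanSpace ℂ (Fin 3) := fun k =>
    mFourierCoeff (EuclideanSpace.complexify ∘ (u.1 : UnitAddTorus (Fin 3) → EuclideanSpace ℝ (Fin 3))) k
  have hΨc : ∀ n, Continuous (Ψ n) := fun n => continuous_pi fun k =>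
    (continuous_mFourierCoeff_synth (hg n) (θ n) k).comp (continuous_const.add continuous_fst)
  show Tendsto (fun n => ∫ y, ρ n y * |X n - c (Ψ n y)|
    ∂((volume : Measure (EuclideanSpace ℝ (Fin (D n)))).prod (volume : Measure ℝ))) atTop (𝓝 |Xlim - c x₀|)
  rw [Metric.tendsto_nhds]
  intro ε' hε'
  have hε4 : 0 < ε' / 4 := by positivity
  have h1 : ∀ᶠ n in atTop, |X n - Xlim| < ε' / 4 := by
    have h := Metric.tendsto_nhds.1 hX (ε' / 4) hε4
    simp_rw [Real.dist_eq] at h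
    exact h
  filter_upwards [h1, marg_pointwise hR0 D g N δ θ hN hδ hδ0 hθ hg horth u hu hgH
    (hc.comp continuous_fst) hε4] with n hn1 hn2
  have hFc : Continuous fun y => |X n - c (Ψ n y)| := (continuous_const.sub (hc.comp (hΨc n))).abs
  have hi1 : Integrable (fun y => ρ n y * |X n - c (Ψ n y)|)
      ((volume : Measure (EuclideanSpace ℝ (Fin (D n)))).prod (volume : Measure ℝ)) :=
    (hρi n).mul_bdd hFc.aestronglyMeasurable (Eventually.of_forall fun y => by
      rw [Real.norm_eq_abs, abs_abs]; exact (abs_sub _ _).trans (add_le_add le_rfl (hB _)))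
  have heq : (∫ y, ρ n y * |X n - c (Ψ n y)| ∂((volume : Measure (EuclideanSpace ℝ (Fin (D n)))).prod
      (volume : Measure ℝ))) - |Xlim - c x₀| = ∫ y, ρ n y * (|X n - c (Ψ n y)| - |Xlim - c x₀|)
        ∂((volume : Measure (EuclideanSpace ℝ (Fin (D n)))).prod (volume : Measure ℝ)) := by
    simp_rw [mul_sub]
    rw [integral_sub hi1 ((hρi n).mul_const _), integral_mul_const, hρ1 n, one_mul]
  rw [Real.dist_eq, heq]
  have hpt : ∀ y, ‖ρ n y * (|X n - c (Ψ n y)| - |Xlim - c x₀|)‖ ≤ ε' / 2 * ρ n y := fun y => by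
    by_cases hy : ρ n y = 0
    · rw [hy, zero_mul, norm_zero, mul_zero]
    obtain ⟨hy1, hy2⟩ := hρδ n y hy
    have h : |c (Ψ n y) - c x₀| < ε' / 4 := hn2 y hy1 hy2
    rw [Real.norm_eq_abs, abs_mul, abs_of_nonneg (hρ0 n y), mul_comm]
    refine mul_le_mul_of_nonneg_right ?_ (hρ0 n y)
    have h3 : |(|X n - c (Ψ n y)| - |Xlim - c x₀|)| ≤ |X n - Xlim| + |c (Ψ n y) - c x₀| :=
      calc |(|X n - c (Ψ n y)| - |Xlim - c x₀|)| ≤ |(X n - c (Ψ n y)) - (Xlim - c x₀)| := abs_abs_sub_abs_le _ _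
        _ = |(X n - Xlim) - (c (Ψ n y) - c x₀)| := by
            rw [show X n - c (Ψ n y) - (Xlim - c x₀) = X n - Xlim - (c (Ψ n y) - c x₀) by ring]
        _ ≤ |X n - Xlim| + |c (Ψ n y) - c x₀| := abs_sub _ _
    linarith
  calc |∫ y, ρ n y * (|X n - c (Ψ n y)| - |Xlim - c x₀|)
        ∂((volume : Measure (EuclideanSpace ℝ (Fin (D n)))).prod (volume : Measure ℝ))|
      ≤ ∫ y, ε' / 2 * ρ n y ∂((volume : Measure (EuclideanSpace ℝ (Fin (D n)))).prod (volume : Measure ℝ)) := by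
        rw [← Real.norm_eq_abs]
        exact norm_integral_le_of_norm_le ((hρi n).const_mul _) (Eventually.of_forall hpt)
    _ = ε' / 2 := by rw [integral_const_mul, hρ1 n, mul_one]
    _ < ε' := half_lt_self hε'

end Summit.AnomalousDissipation.AnomalousDissipation.Theorems.EnsembleRealization
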